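import Summits.ResolutionOfSingularities.ResolutionOfSingularities.Theorems.PurelyInseparableDim4RidgeBudget
import Summits.ResolutionOfSingularities.ResolutionOfSingularities.Theorems.PurelyInseparableDim4ScopeBlindRationalNorm
import HarnessLib

/-!
# A `decide`-able ISOLATION / COLENGTH (`μ⁺`) certificate kit on presented states
# (cell `res-dim4-pi`, seat res-dim4-p-8 g2 «μ⁺ CERTIFICATE KIT ‖ K»)

[OURS · counted 0 · instrument] Nothing here is a statement about resolution of singularities; resolution in
dimension `≥ 4` / characteristic `p > 0` is NOT proved by anything in this file.

The ISOLATED-regime letters of the cell are read on the ideal `J_q⁺(F) = ⟨D^{(α)}F : 0 < |α| < q⟩`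
(`PIDim4.singLocusIdeal`): the isolation certificate `𝔪₀ᴺ ≤ J_q⁺(F) + 𝔪₀ᴺ⁺¹` (`RidgeBudget.IsCert`,
res-dim4-p-3's `IsolationCert.isIsolated_of_forall_monomial`) and the jet colength
`μ⁺ = dim_K K[x]/(J_q⁺(F) + 𝔪₀ᴺ)` (`RidgeBudget.jetColength`).  The tree proves them state by state by hand
(`IsolationCert.isIsolated_two_fermatCubic`, `WildConesGap.isIsolated_three_floorSpecimen`, ≈ 80 lines each).
This file makes both MECHANICAL on res-dim4-p-13's presented states (`StepKit.SData`, term lists `Terms 4 K`):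

* §1 `vanishBelowB M T` — every live exponent of the term list has total degree `≥ M` — and its transfer
  `evalT T ∈ 𝔪₀ᴹ` (`IsolationCert.mem_originIdeal_pow_iff`); negation of term lists.
* §2 certificate ROWS `row : List (multi-index α, multiplier g_α)`: `comboL L row` presents
  `Σ g_α · D^{(α)}(evalT L)` (`ScopeCover.hasseL`, `ScopeBlind.mulL`), a member of `J_q⁺` when every `α` has
  `0 < |α| < q` (`rowIdxB`); **`memRowB q M L γ row`** checks `x^γ − Σ g_α D^{(α)}F ∈ 𝔪₀ᴹ` coefficient-wise
  and yields `x^γ ∈ J_q⁺(F) + 𝔪₀ᴹ` (`monomial_mem_of_memRowB`).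
* §3 **`isoCertB q N L cert`** (`J_q⁺ ≤ 𝔪₀` by `jInMB` + one row per degree-`N` monomial at level `N + 1`) and
  its soundness **`isCert_of_isoCertB : … → RidgeBudget.IsCert q N (evalT L)`**,
  **`isIsolated_of_isoCertB : … → IsIsolated q (evalT L)`**.
* §4 **`colengthCertB q N L B cert`** (one row per monomial of degree `< N`: `x^γ ≡ Σ_{b ∈ B} λ_b x^b`
  modulo `J_q⁺(F) + 𝔪₀ᴺ`) and **`jetColength_le_of_colengthCertB : … → RidgeBudget.jetColength q N (evalT L)
  ≤ B.length`** (the classes of the monomials `B` span the quotient).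

All checks are structural recursions on lists, settled by `decide` on explicit data (no `native_decide`); the
certificates (multipliers, coefficients) are found OFF-tree by linear algebra over `𝔽_p` and only CHECKED here.
First consumer: `PurelyInseparableDim4HeightBudgetFalse.lean` (`¬ RidgeBudget.HeightBudget 3 3`, critics'
witness H1).  bears_on: LADDER-RESOLUTION:D157-DOOR2 (res-dim4-pi · F4-I(p,p) ISOLATED regime · μ⁺ rows ‖ K).
Supports stmt-ResolutionOfSingularities-16155 (helper).
-/

set_option linter.dupNamespace false -- mandated namespace of this single-conjunct summit

noncomputable section

open MvPolynomial Finset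
open scoped BigOperators

namespace Summit.ResolutionOfSingularities.ResolutionOfSingularities.Theorems.PIDim4

namespace ColengthCert

open StepKit ScopeCover ScopeBlind
open Literature.AlgebraicGeometry.Resolution

variable {K : Type} [Field K] [DecidableEq K]

/-! ## §1 Vanishing below a degree; negation -/

/-- **`evalT T ∈ 𝔪₀ᴹ` as a Boolean check**: every term of the list either has total degree `≥ M` or its
exponent carries total coefficient `0`. [folklore] -/
def vanishBelowB (M : ℕ) (T : Terms 4 K) : Bool :=
  T.all fun t => decide (M ≤ ∑ i, t.1 i) || decide (coeffAt T t.1 = 0)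

omit [DecidableEq K] in
/-- Total degree of `d` read on its value function. [folklore] -/
theorem degree_eq_sum_coe (d : Fin 4 →₀ ℕ) : d.degree = ∑ i, (⇑d) i := by
  rw [← expo_coe d, degree_expo, expo_coe]

/-- **Transfer**: a list passing `vanishBelowB M` presents an element of `𝔪₀ᴹ`. [folklore] -/
theorem mem_originIdeal_pow_of_vanishBelowB {M : ℕ} {T : Terms 4 K} (h : vanishBelowB M T = true) :
    evalT T ∈ originIdeal K ^ M := by
  rw [IsolationCert.mem_originIdeal_pow_iff]
  intro d hd
  rw [coeff_evalT]
  by_cases hmem : ∃ t ∈ T, t.1 = ⇑d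
  · obtain ⟨t, ht, hte⟩ := hmem
    simp only [vanishBelowB, List.all_eq_true, Bool.or_eq_true, decide_eq_true_eq] at h
    rcases h t ht with hM | hc
    · exfalso
      rw [hte, ← degree_eq_sum_coe] at hM
      omega
    · rwa [hte] at hc
  · exact coeffAt_eq_zero_of_forall_ne fun t ht hte => hmem ⟨t, ht, hte⟩

/-- Negation of a term list. [folklore] -/
def negL (T : Terms 4 K) : Terms 4 K := T.map fun t => (t.1, -t.2)

omit [DecidableEq K] in
/-- Transfer of `negL`. [folklore] -/
theorem evalT_negL (T : Terms 4 K) : evalT (negL T) = -evalT T := by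
  induction T with
  | nil => simp [negL]
  | cons t T ih =>
    simp only [negL, List.map_cons, evalT_cons] at ih ⊢
    rw [ih, neg_add, map_neg]

/-! ## §2 Certificate rows: explicit members of `J_q⁺(F)` -/

/-- A **certificate row**: pairs (multi-index `α`, multiplier `g_α` as a term list). [folklore] -/
abbrev Row (K : Type) : Type := List ((Fin 4 → ℕ) × Terms 4 K)

/-- The combination `Σ g_α · D^{(α)}(evalT L)` presented on term lists. [folklore] -/
def comboL (L : Terms 4 K) : Row K → Terms 4 K
  | [] => []
  | r :: row => mulL r.2 (hasseL r.1 L) ++ comboL L row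

/-- Every multi-index of the row has `0 < |α| < q`. [folklore] -/
def rowIdxB (q : ℕ) (row : Row K) : Bool :=
  row.all fun r => decide (0 < ∑ i, r.1 i) && decide (∑ i, r.1 i < q)

omit [DecidableEq K] in
/-- **Transfer**: a row with admissible multi-indices presents a member of `J_q⁺(evalT L)`.
[cite: Giraud1975, §1 (Hasse–Schmidt derivations)] -/
theorem evalT_comboL_mem {q : ℕ} (L : Terms 4 K) {row : Row K} (h : rowIdxB q row = true) :
    evalT (comboL L row) ∈ singLocusIdeal q (evalT L) := by
  induction row with
  | nil => simp [comboL]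
  | cons r row ih =>
    simp only [rowIdxB, List.all_cons, Bool.and_eq_true, decide_eq_true_eq] at h
    obtain ⟨⟨h0, hq⟩, hrest⟩ := h
    rw [comboL, evalT_append, evalT_mulL, ← hasseDeriv_evalT]
    refine Ideal.add_mem _ (Ideal.mul_mem_left _ _ (Ideal.subset_span ⟨expo r.1, ?_, ?_, rfl⟩)) (ih ?_)
    · rw [degree_expo]; exact h0
    · rw [degree_expo]; exact hq
    · simpa only [rowIdxB, Bool.and_eq_true, decide_eq_true_eq] using hrest

/-- **One membership row**: `x^γ − Σ g_α D^{(α)}F ∈ 𝔪₀ᴹ`, checked coefficient-wise on the normalised list.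
[folklore] -/
def memRowB (q M : ℕ) (L : Terms 4 K) (γ : Fin 4 → ℕ) (row : Row K) : Bool :=
  rowIdxB q row && vanishBelowB M (normL ((γ, 1) :: negL (comboL L row)))

/-- **Soundness of a membership row**: `x^γ ∈ J_q⁺(evalT L) + 𝔪₀ᴹ`.
[cite: AtiyahMacdonald1969, Ch. 1 Ex. 1.1 (the ideal (x₁,…,xₙ))] -/
theorem monomial_mem_of_memRowB {q M : ℕ} {L : Terms 4 K} {γ : Fin 4 → ℕ} {row : Row K}
    (h : memRowB q M L γ row = true) :
    monomial (expo γ) (1 : K) ∈ singLocusIdeal q (evalT L) ⊔ originIdeal K ^ M := by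
  simp only [memRowB, Bool.and_eq_true] at h
  obtain ⟨h1, h2⟩ := h
  have hG := evalT_comboL_mem L h1
  have hR : monomial (expo γ) (1 : K) - evalT (comboL L row) ∈ originIdeal K ^ M := by
    have := mem_originIdeal_pow_of_vanishBelowB h2
    rwa [evalT_normL, evalT_cons, evalT_negL, ← sub_eq_add_neg] at this
  have heq : monomial (expo γ) (1 : K) =
      evalT (comboL L row) + (monomial (expo γ) 1 - evalT (comboL L row)) := by ring
  rw [heq]
  exact Submodule.add_mem_sup hG hR

/-! ## §3 The isolation certificate -/

/-- All exponent functions `![a, b, c, d]` of total degree exactly `N`. [folklore] -/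
def monosN (N : ℕ) : List (Fin 4 → ℕ) :=
  (List.range (N + 1)).flatMap fun a => (List.range (N + 1)).flatMap fun b =>
    (List.range (N + 1)).flatMap fun c => (List.range (N + 1)).filterMap fun d =>
      if a + b + c + d = N then some ![a, b, c, d] else none

omit [Field K] [DecidableEq K] in
/-- `monosN N` enumerates every exponent of degree `N`. [folklore] -/
theorem mem_monosN {N : ℕ} {γ : Fin 4 →₀ ℕ} (h : γ.degree = N) : (⇑γ) ∈ monosN N := by
  have hsum : γ.degree = γ 0 + γ 1 + γ 2 + γ 3 := by
    rw [← CentreBlowup.degIn_univ]; simp [CentreBlowup.degIn, Fin.sum_univ_four]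
  have hfun : (⇑γ) = ![γ 0, γ 1, γ 2, γ 3] := by funext i; fin_cases i <;> rfl
  rw [hfun]
  simp only [monosN, List.mem_flatMap, List.mem_range, List.mem_filterMap]
  refine ⟨γ 0, by omega, γ 1, by omega, γ 2, by omega, γ 3, by omega, ?_⟩
  rw [if_pos (by omega)]

/-- **`J_q⁺(evalT L) ≤ 𝔪₀` as a Boolean check**: no Hasse derivative of order in `(0, q)` has a constant
term. [folklore] -/
def jInMB (q : ℕ) (L : Terms 4 K) : Bool :=
  (idxLT q).all fun α => decide (coeffAt (hasseL α L) 0 = 0)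

/-- Transfer of `jInMB`. [cite: Giraud1975, §1 (Hasse–Schmidt derivations)] -/
theorem singLocusIdeal_le_of_jInMB {q : ℕ} {L : Terms 4 K} (h : jInMB q L = true) :
    singLocusIdeal q (evalT L) ≤ originIdeal K := by
  simp only [jInMB, List.all_eq_true, decide_eq_true_eq] at h
  refine IsolationCert.singLocusIdeal_le_originIdeal_of_forall fun α h0 hq => ?_
  rw [← expo_coe α, hasseDeriv_evalT]
  change coeff 0 (evalT (hasseL (⇑α) L)) = 0
  rw [coeff_evalT, Finsupp.coe_zero]
  exact h (⇑α) (mem_idxLT h0 hq)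

/-- **The isolation certificate check** at level `N`: `J_q⁺ ≤ 𝔪₀`, and every degree-`N` monomial has a
membership row at level `N + 1` (`𝔪₀ᴺ ≤ J_q⁺ + 𝔪₀ᴺ⁺¹`). [folklore] -/
def isoCertB (q N : ℕ) (L : Terms 4 K) (cert : List ((Fin 4 → ℕ) × Row K)) : Bool :=
  jInMB q L && (monosN N).all (fun γ => cert.any fun c => decide (c.1 = γ)) &&
    cert.all fun c => memRowB q (N + 1) L c.1 c.2

/-- **Soundness (certificate level)**: `isoCertB` gives `RidgeBudget.IsCert q N (evalT L)`.
[cite: AtiyahMacdonald1969, Prop. 2.6 / Cor. 2.7 (Nakayama's lemma)] -/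
theorem isCert_of_isoCertB {q N : ℕ} {L : Terms 4 K} {cert : List ((Fin 4 → ℕ) × Row K)}
    (h : isoCertB q N L cert = true) : RidgeBudget.IsCert q N (evalT L) := by
  simp only [isoCertB, Bool.and_eq_true, List.all_eq_true, List.any_eq_true, decide_eq_true_eq] at h
  obtain ⟨⟨-, hcov⟩, hrows⟩ := h
  refine IsolationCert.pow_le_sup_pow_succ_of_forall_monomial fun γ hγ => ?_
  obtain ⟨c, hc, hcγ⟩ := hcov (⇑γ) (mem_monosN hγ)
  have := monomial_mem_of_memRowB (hrows c hc)
  rwa [hcγ, expo_coe] at this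

/-- **Soundness (isolation)**: `isoCertB` gives `IsIsolated q (evalT L)`.
[cite: AtiyahMacdonald1969, Prop. 2.6 / Cor. 2.7 (Nakayama's lemma)] -/
theorem isIsolated_of_isoCertB {q N : ℕ} {L : Terms 4 K} {cert : List ((Fin 4 → ℕ) × Row K)}
    (h : isoCertB q N L cert = true) : IsIsolated q (evalT L) := by
  have hJ : singLocusIdeal q (evalT L) ≤ originIdeal K := by
    simp only [isoCertB, Bool.and_eq_true] at h
    exact singLocusIdeal_le_of_jInMB h.1.1
  exact IsolationCert.isIsolated_of_pow_le_sup_pow_succ hJ (isCert_of_isoCertB h)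

/-- The same two facts for a presented state `s : SData 4 K`. [folklore] -/
theorem isIsolated_toState_of_isoCertB {q N : ℕ} {s : SData 4 K} {cert : List ((Fin 4 → ℕ) × Row K)}
    (h : isoCertB q N s.L cert = true) :
    IsIsolated q s.toState.F ∧ RidgeBudget.IsCert q N s.toState.F :=
  ⟨isIsolated_of_isoCertB h, isCert_of_isoCertB h⟩

/-! ## §4 The colength (spanning) certificate: `μ⁺ ≤ |B|` -/

/-- All exponent functions of total degree `< N`. [folklore] -/
def monosLT (N : ℕ) : List (Fin 4 → ℕ) := (List.range N).flatMap monosN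

omit [Field K] [DecidableEq K] in
/-- `monosLT N` enumerates every exponent of degree `< N`. [folklore] -/
theorem mem_monosLT {N : ℕ} {γ : Fin 4 →₀ ℕ} (h : γ.degree < N) : (⇑γ) ∈ monosLT N := by
  simp only [monosLT, List.mem_flatMap, List.mem_range]
  exact ⟨γ.degree, h, mem_monosN rfl⟩

/-- The `K`-combination `Σ λ_b · x^b` of basis monomials, as a term list. [folklore] -/
def linL (B : List (Fin 4 → ℕ)) (lam : List K) : Terms 4 K := List.zipWith (fun b l => (b, l)) B lam

/-- **One spanning row**: `x^γ − Σ_{b ∈ B} λ_b x^b − Σ g_α D^{(α)}F ∈ 𝔪₀ᴺ`, checked coefficient-wise.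
[folklore] -/
def spanRowB (q N : ℕ) (L : Terms 4 K) (B : List (Fin 4 → ℕ)) (γ : Fin 4 → ℕ) (lam : List K)
    (row : Row K) : Bool :=
  rowIdxB q row && vanishBelowB N (normL ((γ, 1) :: (negL (linL B lam) ++ negL (comboL L row))))

omit [DecidableEq K] in
/-- `Σ λ_b x^b` maps into the span of the classes of the `x^b`, `b ∈ B`, under any `K`-linear map.
[folklore] -/
theorem map_evalT_linL_mem_span {M : Type} [AddCommGroup M] [Module K M]
    (f : MvPolynomial (Fin 4) K →ₗ[K] M) (B : List (Fin 4 → ℕ)) (lam : List K) :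
    f (evalT (linL B lam)) ∈ Submodule.span K {m | ∃ b ∈ B, m = f (monomial (expo b) 1)} := by
  induction B generalizing lam with
  | nil => simp [linL]
  | cons b B ih =>
    cases lam with
    | nil => simp [linL]
    | cons l lam =>
      simp only [linL, List.zipWith_cons_cons, evalT_cons, map_add] at ih ⊢
      refine Submodule.add_mem _ ?_ (Submodule.span_mono (fun m hm => ?_) (ih lam))
      swap
      · obtain ⟨b', hb', hm⟩ := hm
        exact ⟨b', List.mem_cons_of_mem _ hb', hm⟩
      have : monomial (expo b) l = l • monomial (expo b) (1 : K) := by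
        rw [smul_monomial, smul_eq_mul, mul_one]
      rw [this, map_smul]
      exact Submodule.smul_mem _ _ (Submodule.subset_span ⟨b, by simp, rfl⟩)

/-- **Soundness of a spanning row**: the class of `x^γ` modulo `J_q⁺ + 𝔪₀ᴺ` lies in the span of the
classes of the `x^b`, `b ∈ B`. [cite: AtiyahMacdonald1969, Prop. 6.9 (length is additive)] -/
theorem mk_monomial_mem_span_of_spanRowB {q N : ℕ} {L : Terms 4 K} {B : List (Fin 4 → ℕ)}
    {γ : Fin 4 → ℕ} {lam : List K} {row : Row K} (h : spanRowB q N L B γ lam row = true) :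
    Ideal.Quotient.mkₐ K (singLocusIdeal q (evalT L) ⊔ originIdeal K ^ N) (monomial (expo γ) 1) ∈
      Submodule.span K {m | ∃ b ∈ B, m = Ideal.Quotient.mkₐ K
        (singLocusIdeal q (evalT L) ⊔ originIdeal K ^ N) (monomial (expo b) 1)} := by
  set I := singLocusIdeal q (evalT L) ⊔ originIdeal K ^ N
  set f := (Ideal.Quotient.mkₐ K I).toLinearMap
  simp only [spanRowB, Bool.and_eq_true] at h
  obtain ⟨h1, h2⟩ := h
  have hG := evalT_comboL_mem L h1
  have hR := mem_originIdeal_pow_of_vanishBelowB h2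
  rw [evalT_normL, evalT_cons, evalT_append, evalT_negL, evalT_negL] at hR
  -- `x^γ − Σ λ_b x^b ∈ I`
  have hI : monomial (expo γ) (1 : K) - evalT (linL B lam) ∈ I := by
    have heq : monomial (expo γ) (1 : K) - evalT (linL B lam) =
        evalT (comboL L row) + (monomial (expo γ) 1 + (-evalT (linL B lam) + -evalT (comboL L row))) := by
      ring
    rw [heq]
    exact Submodule.add_mem_sup hG hR
  have hzero : f (monomial (expo γ) (1 : K) - evalT (linL B lam)) = 0 := by
    change Ideal.Quotient.mkₐ K I _ = 0
    rw [Ideal.Quotient.mkₐ_eq_mk, Ideal.Quotient.eq_zero_iff_mem]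
    exact hI
  rw [map_sub, sub_eq_zero] at hzero
  change f (monomial (expo γ) 1) ∈ _
  rw [hzero]
  exact map_evalT_linL_mem_span f B lam

/-- **The colength certificate check** at level `N` with basis list `B`: one spanning row per monomial
of degree `< N`. [folklore] -/
def colengthCertB (q N : ℕ) (L : Terms 4 K) (B : List (Fin 4 → ℕ))
    (cert : List ((Fin 4 → ℕ) × List K × Row K)) : Bool :=
  (monosLT N).all (fun γ => cert.any fun c => decide (c.1 = γ)) &&
    cert.all fun c => spanRowB q N L B c.1 c.2.1 c.2.2

/-- **Soundness (colength bound)**: `colengthCertB` gives `μ⁺ = jetColength q N (evalT L) ≤ B.length` —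
the classes of the monomials `x^b`, `b ∈ B`, span `K[x] ⧸ (J_q⁺ + 𝔪₀ᴺ)` (monomials of degree `≥ N`
die, the others are certified combinations). [cite: AtiyahMacdonald1969, Prop. 6.9 (length is additive)] -/
theorem jetColength_le_of_colengthCertB {q N : ℕ} {L : Terms 4 K} {B : List (Fin 4 → ℕ)}
    {cert : List ((Fin 4 → ℕ) × List K × Row K)} (h : colengthCertB q N L B cert = true) :
    RidgeBudget.jetColength q N (evalT L) ≤ B.length := by
  classical
  simp only [colengthCertB, Bool.and_eq_true, List.all_eq_true, List.any_eq_true,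
    decide_eq_true_eq] at h
  obtain ⟨hcov, hrows⟩ := h
  set I := singLocusIdeal q (evalT L) ⊔ originIdeal K ^ N with hI
  set f := (Ideal.Quotient.mkₐ K I).toLinearMap with hf
  set W : Submodule K (MvPolynomial (Fin 4) K ⧸ I) :=
    Submodule.span K {m | ∃ b ∈ B, m = Ideal.Quotient.mkₐ K I (monomial (expo b) 1)} with hW
  -- every monomial class lies in `W`
  have hmono : ∀ d : Fin 4 →₀ ℕ, f (monomial d 1) ∈ W := by
    intro d
    by_cases hd : d.degree < N
    · obtain ⟨c, hc, hcd⟩ := hcov (⇑d) (mem_monosLT hd)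
      have := mk_monomial_mem_span_of_spanRowB (hrows c hc)
      rw [hcd, expo_coe] at this
      exact this
    · have hmem : monomial d (1 : K) ∈ I := by
        refine Ideal.mem_sup_right ?_
        rw [IsolationCert.mem_originIdeal_pow_iff]
        intro d' hd'
        rw [coeff_monomial, if_neg]
        rintro rfl
        exact hd hd'
      have : f (monomial d 1) = 0 := by
        change Ideal.Quotient.mkₐ K I _ = 0
        rw [Ideal.Quotient.mkₐ_eq_mk, Ideal.Quotient.eq_zero_iff_mem]
        exact hmem
      rw [this]
      exact Submodule.zero_mem _
  -- hence `W = ⊤`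
  have htop : W = ⊤ := by
    refine Submodule.eq_top_iff'.mpr fun x => ?_
    obtain ⟨G, rfl⟩ := Ideal.Quotient.mkₐ_surjective K I x
    change f G ∈ W
    rw [G.as_sum, map_sum]
    refine Submodule.sum_mem _ fun d _ => ?_
    have : monomial d (coeff d G) = coeff d G • monomial d (1 : K) := by
      rw [smul_monomial, smul_eq_mul, mul_one]
    rw [this, map_smul]
    exact Submodule.smul_mem _ _ (hmono d)
  -- and `finrank ≤ |B|`
  have hfin : {m | ∃ b ∈ B, m = Ideal.Quotient.mkₐ K I (monomial (expo b) 1)} =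
      ↑((B.map fun b => Ideal.Quotient.mkₐ K I (monomial (expo b) 1)).toFinset) := by
    ext m
    simp only [Set.mem_setOf_eq, List.coe_toFinset, List.mem_map]
    constructor
    · rintro ⟨b, hb, rfl⟩; exact ⟨b, hb, rfl⟩
    · rintro ⟨b, hb, rfl⟩; exact ⟨b, hb, rfl⟩
  unfold RidgeBudget.jetColength
  rw [← hI, ← finrank_top K (MvPolynomial (Fin 4) K ⧸ I), ← htop, hW, hfin]
  refine (finrank_span_finset_le_card _).trans ?_
  exact (List.toFinset_card_le _).trans (by rw [List.length_map])

/-- The colength bound for a presented state `s : SData 4 K`. [folklore] -/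
theorem jetColength_toState_le_of_colengthCertB {q N : ℕ} {s : SData 4 K} {B : List (Fin 4 → ℕ)}
    {cert : List ((Fin 4 → ℕ) × List K × Row K)} (h : colengthCertB q N s.L B cert = true) :
    RidgeBudget.jetColength q N s.toState.F ≤ B.length :=
  jetColength_le_of_colengthCertB h

end ColengthCert

end Summit.ResolutionOfSingularities.ResolutionOfSingularities.Theorems.PIDim4

end
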